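import Summits.BirchSwinnertonDyer.BirchSwinnertonDyer.Theorems.ByReductionTypeAtTwoRankOneAtTwoOneDoorLawFirstLayerDefs
import Literature.NumberTheory.EllipticCurves.BipartiteToricPeriod
import Literature.NumberTheory.EllipticCurves.Selmer
import HarnessLib

/-!
# ES-32 (-es g23) — the 2-adic Ribet–Takahashi / Pollack–Weston comparison on the DEFINITE quaternion algebra,
# and the Watkins–Dummigan Selmer bound (sketch; crux `RankOneAtTwoBigImageOddLocal` = stmt-BirchSwinnertonDyer-23715)

Objects over the ES-31 frame `DefiniteFrame W W' q a b O RI φ` (`B = (a,b)_ℚ` definite ramified exactly at `q`, `O` Eichler of level `N_W`,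
`RI` the invertible right `O`-ideals, `φ : RI → ℤ` the left-`B×`-invariant Hecke eigenfunction of the level-raised curve `W'`, `N_{W'} = q N_W`):
* `unitWeight J = ½ · #{β ∈ B× : βJ = J} = #O_l(J)×/{±1}` (Eichler's `w_i`; mass `Σ 1/w_i`);
* `IsClassSet RI S`: `S` is a set of representatives of the left-`B×`-classes on `RI` (`#S = h`, the class number);
* `grossSelfPairing φ S = Σ_{J ∈ S} φ(J)² / w_J ∈ ℚ` (the Petersson/Gross height pairing of `φ` with itself, functions normalisation);
* `classGcd φ S = gcd_{J,J' ∈ S} (φ J − φ J')` (the BRANDT INDEX of `φ`; `= #image(Φ_{J₀(qN),q} → Φ_{E,q})` by Conrad–Stein + Ribet, ENGINE 32).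

Statements (MEMO-es §32): ES-32A `TamagawaExponentIdentity` (`deg · I_φ² = e_q · ⟨φ,φ⟩_w`, PRINT: Conrad–Stein 2001 Thm 6.1/8.2; ENGINE 32
293/293 + pilots 50/50, all strata incl. `4 ∣ N`, `9 ∣ N`) and ES-32A′ `BrandtIndexOddAtTwo` (PRINT: Ribet 1990 Thm 3.12; 240/240) are SUPPORT —
together: on the crux's frame `v₂(deg π_E) = v₂⟨φ,φ⟩_w + v₂(e_q)` (240/240), the «period comparison at 2» of the jochnowitz_two / one_door lines.
ES-32B `WatkinsSelmerBoundAtTwo` (`#Sel₂ ≤ 2^{v₂ deg} · #E(ℚ)[2]`; ENGINE 32S: 38 042/38 042 optimal curves `N ≤ 10⁴`, 437 226/437 226 `N ≤ 10⁵`), ES-32B♯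
`SelmerAtkinLehnerFloorAtTwo` (`dimSel₂ + ω_odd(N) − 1 + c(v₂N) ≤ v₂(deg)` for `E(ℚ)[2] = 0`; 25 195/25 195 tight 3 438, then out of sample
313 185/313 185 tight 23 084 for `N ≤ 10⁵`) and its slice form `ALMinimalDegreeSelmerTrivialOnSlice` (crux hypotheses + AL-minimal degree ⟹
`Sel₂(W) ≅ ℤ/2`; 1 435/1 435 and 9 613/9 613) are the lens's CONJECTURES
(`@[conjecture]`), with the kernel glue `alMinimal_of_floor`.  Nothing here is a theorem beyond print; BSD is not proved.
-/

open scoped Classical BigOperators AddSubgroup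

noncomputable section

set_option linter.dupNamespace false
set_option autoImplicit false

namespace Summit.BirchSwinnertonDyer.BirchSwinnertonDyer.Theorems.RankOneAtTwoTamagawaExponent

open Literature.NumberTheory.EllipticCurves Literature.NumberTheory.EllipticCurves.ModularForms
  Summit.BirchSwinnertonDyer.Rank1Residual.F1Sign2
  Summit.BirchSwinnertonDyer.BirchSwinnertonDyer.Theorems.RankOneAtTwoOneDoor
  WeierstrassCurve

/-! ### The ES-31 frame vocabulary (copied VERBATIM from the crux workfile `Cruxes/RankOneAtTwoBigImageOddLocal/JochnowitzSecondDigitES31.lean`,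
declared there in namespace `…Theorems.RankOneAtTwoJochnowitz`, which is not an importable module) -/

/-- The `2`-division cubic `4x³ + b₂x² + 2b₄x + b₆` of `W` (as in the -es g19/g21 workfiles). -/
abbrev twoDivCubic (W : WeierstrassCurve ℚ) : Polynomial ℚ := W.twoTorsionPolynomial.toPoly

/-- `ρ̄_{W,2}|_{G_{ℚ₂}}` is non-trivial: the `2`-division cubic does not split completely over `ℚ₂` (Le Hung–Li 2016, Assumption (4);
the ES-28E frame hypothesis — off it, ENGINE J31 finds the one counterexample family `503a1, q = 5`). -/
def NontrivialAtTwo (W : WeierstrassCurve ℚ) : Prop :=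
  ((twoDivCubic W).map (algebraMap ℚ ℚ_[2])).roots.card < 3

/-- **THE DEFINITE LEVEL-RAISING FRAME** `(W, W', q; B = (a,b)_ℚ, O, RI, φ)`: `W'` of conductor `q·N_W` (`q ∤ N_W`) congruent to `W`
modulo `2` (traces of Frobenius at all primes `ℓ ∤ 2qN_W`); `B = (a, 0, b)_ℚ` definite and a division algebra exactly at `q` among the
finite primes; `O = O₁ ⊓ O₂` an Eichler order of level `N_W` (two maximal `ℤ`-orders, `[O₁ : O] = N_W`); `RI` the invertible right
`O`-ideals; `φ : RI → ℤ` left-`B×`-invariant with `T_ℓ φ = a_ℓ(W') φ` for every prime `ℓ ∤ qN_W` (the Jacquet–Langlands transfer `g_B`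
of the newform of `W'`, any integral multiple) and PRIMITIVE AT `2` (an odd value).  Clauses copied from
`kim_selmerCorank_baseChange_le_of_toricPeriod_ne_zero` with `N⁻ = 1`, `n = q`, `ℤ`-values. [cite: Kim2024, §5.2.2–5.2.3 (shape of the binders)]
[cite: GrossLMS1987, §3 and Prop. 10.3 (heights and the special value formula; shape only)] -/
def DefiniteFrame (W W' : WeierstrassCurve ℚ) [W.IsElliptic] [W.IsGloballyMinimal] [W'.IsElliptic] [W'.IsGloballyMinimal]
    (q : ℕ) (a b : ℚ)
    (O : Subring (QuaternionAlgebra ℚ a 0 b)) (RI : Set (Submodule ℤ (QuaternionAlgebra ℚ a 0 b)))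
    (φ : Submodule ℤ (QuaternionAlgebra ℚ a 0 b) → ℤ) : Prop :=
  -- frame of ES-28 (Le Hung–Li): `4 ∤ N_W`, `ρ̄|_{G_{ℚ₂}} ≠ 1`, `q ∤ 2N_W` a TRANSPOSITION prime
  (¬ 4 ∣ W.conductorNorm ℤ) ∧ NontrivialAtTwo W ∧ q ≠ 2 ∧ (¬ q ∣ W.conductorNorm ℤ) ∧ jacobiSym W.Δ.num q = -1 ∧
  -- level
  (W'.conductorNorm ℤ = q * W.conductorNorm ℤ) ∧
  -- congr
  (∀ ℓ : ℕ, ℓ.Prime → ¬ ℓ ∣ 2 * q * W.conductorNorm ℤ → (2 : ℤ) ∣ W.frobeniusTrace ℓ - W'.frobeniusTrace ℓ) ∧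
  -- definite
  (a < 0 ∧ b < 0) ∧
  -- ramified
  (∀ (ℓ : ℕ) [Fact ℓ.Prime],
    (∀ x : QuaternionAlgebra ℚ_[ℓ] (a : ℚ_[ℓ]) 0 (b : ℚ_[ℓ]), x ≠ 0 → IsUnit x) ↔ ℓ = q) ∧
  -- eichler
  (∃ O₁ O₂ : Subring (QuaternionAlgebra ℚ a 0 b),
    (∀ S : Subring (QuaternionAlgebra ℚ a 0 b), (S = O₁ ∨ S = O₂) →
      (S.toAddSubgroup.FG ∧ (∀ d : QuaternionAlgebra ℚ a 0 b, ∃ m : ℤ, m ≠ 0 ∧ m • d ∈ S) ∧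
        ∀ S' : Subring (QuaternionAlgebra ℚ a 0 b), S'.toAddSubgroup.FG → S ≤ S' → S' = S)) ∧
    O = O₁ ⊓ O₂ ∧ O.toAddSubgroup.relIndex O₁.toAddSubgroup = W.conductorNorm ℤ) ∧
  -- ideals
  (∀ J : Submodule ℤ (QuaternionAlgebra ℚ a 0 b), J ∈ RI ↔
    (J.FG ∧ (∀ d : QuaternionAlgebra ℚ a 0 b, ∃ m : ℤ, m ≠ 0 ∧ m • d ∈ J) ∧
      (∀ x : QuaternionAlgebra ℚ a 0 b, (∀ y ∈ J, y * x ∈ J) ↔ x ∈ O) ∧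
      (∃ J' : Submodule ℤ (QuaternionAlgebra ℚ a 0 b),
        (∀ x : QuaternionAlgebra ℚ a 0 b, x ∈ J * J' ↔ ∀ y ∈ J, x * y ∈ J) ∧
        (∀ x : QuaternionAlgebra ℚ a 0 b, x ∈ J' * J ↔ x ∈ O)))) ∧
  -- invariant
  (∀ J ∈ RI, ∀ β : QuaternionAlgebra ℚ a 0 b, IsUnit β →
    φ (J.map (AddMonoidHom.mulLeft β).toIntLinearMap) = φ J) ∧
  -- eigen
  (∀ ℓ : ℕ, ℓ.Prime → ¬ ℓ ∣ q * W.conductorNorm ℤ → ∀ J ∈ RI,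
    ∑ᶠ J' ∈ {J' : Submodule ℤ (QuaternionAlgebra ℚ a 0 b) | J' ≤ J ∧
        J'.toAddSubgroup.relIndex J.toAddSubgroup = ℓ ^ 2 ∧ ∀ y ∈ J', ∀ x ∈ O, y * x ∈ J'}, φ J' =
      W'.frobeniusTrace ℓ * φ J) ∧
  -- primitive
  (∃ J ∈ RI, Odd (φ J))

variable {a b : ℚ}

/-- Eichler's unit weight `w_J = ½ #{β ∈ B× : βJ = J}` (`= #O_l(J)^×/2`; finite since `B` is definite). -/
noncomputable def unitWeight (J : Submodule ℤ (QuaternionAlgebra ℚ a 0 b)) : ℕ :=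
  Nat.card {β : QuaternionAlgebra ℚ a 0 b // IsUnit β ∧ J.map (AddMonoidHom.mulLeft β).toIntLinearMap = J} / 2

/-- `S` is a complete set of representatives of the left-`B×`-classes of `RI`. -/
def IsClassSet (RI : Set (Submodule ℤ (QuaternionAlgebra ℚ a 0 b))) (S : Finset (Submodule ℤ (QuaternionAlgebra ℚ a 0 b))) : Prop :=
  (↑S ⊆ RI) ∧ ∀ J ∈ RI, ∃! J₀, J₀ ∈ S ∧ ∃ β : QuaternionAlgebra ℚ a 0 b, IsUnit β ∧ J = J₀.map (AddMonoidHom.mulLeft β).toIntLinearMap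

/-- The Gross/Petersson self-pairing `⟨φ, φ⟩ = Σ_{J ∈ S} φ(J)² / w_J` (functions normalisation; ENGINE 32's `ppF`). -/
noncomputable def grossSelfPairing (φ : Submodule ℤ (QuaternionAlgebra ℚ a 0 b) → ℤ)
    (S : Finset (Submodule ℤ (QuaternionAlgebra ℚ a 0 b))) : ℚ :=
  ∑ J ∈ S, ((φ J : ℚ) ^ 2) / (unitWeight J : ℚ)

/-- The BRANDT INDEX `I_φ = gcd_{J, J' ∈ S} (φ J − φ J')` (ENGINE 32's `GF`). -/
def classGcd (φ : Submodule ℤ (QuaternionAlgebra ℚ a 0 b) → ℤ) (S : Finset (Submodule ℤ (QuaternionAlgebra ℚ a 0 b))) : ℕ :=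
  S.gcd fun J => S.gcd fun J' => (φ J - φ J').natAbs

/-- `φ` is primitive on `S`: `gcd_{J ∈ S} φ(J) = 1`. -/
def IsPrimitiveOn (φ : Submodule ℤ (QuaternionAlgebra ℚ a 0 b) → ℤ) (S : Finset (Submodule ℤ (QuaternionAlgebra ℚ a 0 b))) : Prop :=
  (S.gcd fun J => (φ J).natAbs) = 1

/-- **ES-32A `TamagawaExponentIdentity` — IN PRINT (Conrad–Stein 2001 Thm 6.1 + Thm 8.2, with Ribet 1990's identification of the character
group at `q` of `J₀(qN)` with `ℤ[S]⁰`; Pollack–Weston's «Tamagawa exponent» at `N⁻ = q`).**  On the frame, for the `X₀(qN_W)`-OPTIMAL curve `W₀`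
of the isogeny class of `W'` with optimal parametrisation datum `D₀`:  `deg(D₀) · I_φ² = v_q(Δ_{W₀}) · ⟨φ, φ⟩`.  ENGINE 32 (j334478, j334618,
j334662): identity holds in 100 % of the computed `(E, q)` pairs.  Filed as SUPPORT (a Literature port ask), not as a conjecture.
[cite: ConradStein2001, Thm. 6.1 and Thm. 8.2] [cite: Ribet1990, Prop. 3.1–3.3 and Thm. 3.12 (shape)] [cite: PollackWeston2011, Prop. (prop:char) (p ≥ 5 analogue)] -/
def TamagawaExponentIdentity : Prop :=
  ∀ (W : WeierstrassCurve ℚ) [W.IsElliptic] [W.IsGloballyMinimal] [NeZero (W.conductorNorm ℤ)]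
    (W' : WeierstrassCurve ℚ) [W'.IsElliptic] [W'.IsGloballyMinimal] (q : ℕ) [Fact q.Prime]
    (a b : ℚ) (O : Subring (QuaternionAlgebra ℚ a 0 b)) (RI : Set (Submodule ℤ (QuaternionAlgebra ℚ a 0 b)))
    (φ : Submodule ℤ (QuaternionAlgebra ℚ a 0 b) → ℤ), DefiniteFrame W W' q a b O RI φ →
    ∀ S : Finset (Submodule ℤ (QuaternionAlgebra ℚ a 0 b)), IsClassSet RI S → IsPrimitiveOn φ S →
    ∀ (W₀ : WeierstrassCurve ℚ) [W₀.IsElliptic] [W₀.IsGloballyMinimal] (D₀ : ModularParametrizationData W₀ (q * W.conductorNorm ℤ)),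
      WeierstrassCurve.IsIsogenous W₀ W' →
      (∀ (W'' : WeierstrassCurve ℚ) [W''.IsElliptic] (D'' : ModularParametrizationData W'' (q * W.conductorNorm ℤ)),
        D''.f = D₀.f → D₀.modularDegree ≤ D''.modularDegree) →
      (D₀.modularDegree : ℚ) * (classGcd φ S : ℚ) ^ 2 = (padicValRat q W₀.Δ : ℚ) * grossSelfPairing φ S

/-- **ES-32A′ `BrandtIndexOddAtTwo` — IN PRINT (Ribet 1990 Thm 3.12 / Edixhoven 1991: `Φ_q(J₀(qN))` is Eisenstein, so `ℓ ∣ I_φ ⟹ ρ̄_{E,ℓ}`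
reducible; on the frame `ρ̄_{W',2} ≅ ρ̄_{W,2}` is irreducible).**  The Brandt index of a level-raised curve of the crux's `W` is ODD; with ES-32A:
`v₂(deg D₀) = v₂⟨φ,φ⟩ + v₂(v_q Δ_{W₀})` — the `p = 2` Pollack–Weston Tamagawa-exponent formula, by citation.  ENGINE 32: `v₂(I) = 0` in 100 % of
pairs with `E[2]` irreducible.  SUPPORT. [cite: Ribet1990, Thm. 3.12] [cite: Edixhoven1991, §4 (Eisenstein action on Φ)] -/
def BrandtIndexOddAtTwo : Prop :=
  ∀ (W : WeierstrassCurve ℚ) [W.IsElliptic] [W.IsGloballyMinimal] [NeZero (W.conductorNorm ℤ)]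
    (W' : WeierstrassCurve ℚ) [W'.IsElliptic] [W'.IsGloballyMinimal] (q : ℕ) [Fact q.Prime],
    ¬ W.HasCM → (∀ n : ℕ, W.HasSurjectiveModNGaloisRep ((2 ^ n : ℕ) : ℤ)) →
    ∀ (a b : ℚ) (O : Subring (QuaternionAlgebra ℚ a 0 b)) (RI : Set (Submodule ℤ (QuaternionAlgebra ℚ a 0 b)))
      (φ : Submodule ℤ (QuaternionAlgebra ℚ a 0 b) → ℤ), DefiniteFrame W W' q a b O RI φ →
    ∀ S : Finset (Submodule ℤ (QuaternionAlgebra ℚ a 0 b)), IsClassSet RI S → IsPrimitiveOn φ S → Odd (classGcd φ S)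

/-- **ES-32B `WatkinsSelmerBoundAtTwo` — THE CANDIDATE (conjecture of this lens; Watkins' modular-degree conjecture in its `2`-SELMER form,
stated on the tree).**  For every elliptic curve over `ℚ` given by a globally minimal `W` and every OPTIMAL parametrisation datum `D` at level
`N_W` (minimal degree among data with the same newform = the `X₀(N)`-optimal curve of the class):
`#Sel₂(W) ≤ 2^{v₂(deg D)} · #W(ℚ)[2]`, i.e. `dim_{𝔽₂} Sel₂(W) − dim_{𝔽₂} W(ℚ)[2] ≤ v₂(modular degree)`.
For the crux's `W` (rank `1`, `W[2]` irreducible): `dim_{𝔽₂} Ш(W)[2] ≤ v₂(deg) − 1`; with ES-32A/A′ at any level-raising / multiplicative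
prime: `dim Ш(W₀)[2] ≤ v₂⟨φ,φ⟩ + v₂(e_q) − 1` — a DESCENT-FREE bound for `Ш[2]` by the `2`-adic valuation of the Gross self-pairing.
Why it might fail: a rank-`0` curve with odd modular degree and `Ш[2] ≠ 0` (none with `N ≤ 10⁴`: ENGINE 32S census), or high `2`-rank `Ш` at
a level where the Hecke algebra is `2`-adically Gorenstein-defective (Kilford primes `431, 503, 2089`).  Known: `2^r ∣ deg` is Watkins'
Conjecture 4.1 (open; Dummigan: ⟸ an `R = T` theorem at `2`); odd degree ⟹ rank `0` and `N` has ≤ 2 odd prime factors (Calegari–Emerton).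
Census ENGINE 32S j334662 (`38 042` optimal curves, `N ≤ 10⁴`): see MEMO-es §32. [cite: Watkins2002, Conj. 4.1] [cite: Dummigan2006, §1 and Prop. 4.2]
[cite: CalegariEmerton2009, Thm. 1.1] -/
@[conjecture] def WatkinsSelmerBoundAtTwo : Prop :=
  ∀ (W : WeierstrassCurve ℚ) [W.IsElliptic] [W.IsGloballyMinimal] [NeZero (W.conductorNorm ℤ)]
    (D : ModularParametrizationData W (W.conductorNorm ℤ)),
    (∀ (W'' : WeierstrassCurve ℚ) [W''.IsElliptic] (D'' : ModularParametrizationData W'' (W.conductorNorm ℤ)),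
        D''.f = D.f → D.modularDegree ≤ D''.modularDegree) →
    Nat.card (W.selmerGroup 2) ≤ 2 ^ (padicValNat 2 D.modularDegree) * Nat.card (W.toAffine.Point[(2 : ℤ)])

/-- **ES-32B on the slice of the crux** (rank one, big image at `2`): `2 · #Ш`-free form — `#Sel₂(W) ≤ 2^{v₂(deg D)}` and hence, since
`Sel₂ ⊇ W(ℚ)/2 ≅ 𝔽₂`, `#Ш(W)[2] ≤ 2^{v₂(deg D) − 1}`.  Immediate from `WatkinsSelmerBoundAtTwo` (no `2`-torsion under surjective `ρ̄_{W,2}`). -/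
@[conjecture] def WatkinsSelmerBoundOnSlice : Prop :=
  ∀ (W : WeierstrassCurve ℚ) [W.IsElliptic] [W.IsGloballyMinimal] [NeZero (W.conductorNorm ℤ)],
    ¬ W.HasCM → (∀ n : ℕ, W.HasSurjectiveModNGaloisRep ((2 ^ n : ℕ) : ℤ)) → Odd W.torsionOrder → Odd W.tamagawaProduct →
    W.analyticRank = 1 →
    ∀ (D : ModularParametrizationData W (W.conductorNorm ℤ)),
    (∀ (W'' : WeierstrassCurve ℚ) [W''.IsElliptic] (D'' : ModularParametrizationData W'' (W.conductorNorm ℤ)),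
        D''.f = D.f → D.modularDegree ≤ D''.modularDegree) →
    Nat.card (W.selmerGroup 2) ≤ 2 ^ (padicValNat 2 D.modularDegree)

/-- The contribution of the prime `2` to the `2`-adic modular-degree floor, by conductor exponent `v = v₂(N)` (ENGINE 32S, curves with
`E(ℚ)[2] = 0`): `c(0) = 0`, `c(1) = 1` (the Atkin–Lehner involution `w₂`), `c(2) = 0` (sic), `c(v) = ⌈v/2⌉` for `v ≥ 3`; attained in
`1173 / 1766 / 150 / 155 / 77 / 59 / 24 / 30 / 4` curves for `v = 0, …, 8` (`N ≤ 10⁴`). -/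
def twoAdicFloorAtTwo (v : ℕ) : ℕ :=
  if v = 0 then 0 else if v = 1 then 1 else if v = 2 then 0 else (v + 1) / 2

/-- The number of ODD primes of bad reduction, `ω_odd(N) = #{p odd prime : p ∣ N}`. -/
def oddPrimeCount (N : ℕ) : ℕ := (N.primeFactors.filter (fun p => p ≠ 2)).card

/-- **ES-32B♯ `SelmerAtkinLehnerFloorAtTwo` — THE SHARP CANDIDATE (law of this lens; Watkins' «even stronger» Atkin–Lehner suggestion made
precise, with the `2`-adic step function `c`).**  For an optimal `E/ℚ` WITHOUT rational `2`-torsion: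
`dim_{𝔽₂} Sel₂(E) + (ω_odd(N) − 1) + c(v₂(N)) ≤ v₂(deg π_E)`, i.e. `#Sel₂(E) · 2^{ω_odd(N) + c(v₂ N)} ≤ 2 · 2^{v₂(deg)}`.
Census ENGINE 32S j334662: `25 195 / 25 195` optimal curves with `E(ℚ)[2] = 0`, `N ≤ 10⁴`; EQUALITY in `3 438` (so every term is
load-bearing), among them `46` curves with `Ш[2] ≅ (ℤ/2)²`; the uncorrected count `ω(N) − 1` fails exactly at `v₂(N) = 2` (`150` curves).  OUT OF SAMPLE (kit j334983, all `437 226` optimal curves `N ≤ 10⁵`): `313 185 / 313 185`, `23 084` equalities (`911` with Ш), minimum margin `0` in every `v₂(N)`-class; plain Selmer form `437 226 / 437 226`.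
Reading: `v₂(deg) − [Atkin–Lehner/local floor] ≥ dim Sel₂` — the `2`-part of the congruence number left after the local (level) congruences
bounds the `2`-Selmer rank (Dummigan's `R = T` heuristic, reversed into a BOUND).  Why it might fail: a curve with `Ш[2] ≅ (ℤ/2)⁴` at a level
whose `2`-adic Hecke algebra is Gorenstein-defective, or `v₂(N) = 2` hiding a second mechanism; beyond `N = 10⁴` untested. [cite: Dummigan2006, §1 (Watkins' Selmer and Atkin–Lehner refinements) and §5]
[cite: Watkins2002, Conj. 4.1–4.2] [cite: EsparzaLozanoPasten2021, remark after Cor. 1.3 (Selmer form)] -/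
@[conjecture] def SelmerAtkinLehnerFloorAtTwo : Prop :=
  ∀ (W : WeierstrassCurve ℚ) [W.IsElliptic] [W.IsGloballyMinimal] [NeZero (W.conductorNorm ℤ)]
    (D : ModularParametrizationData W (W.conductorNorm ℤ)),
    (∀ (W'' : WeierstrassCurve ℚ) [W''.IsElliptic] (D'' : ModularParametrizationData W'' (W.conductorNorm ℤ)),
        D''.f = D.f → D.modularDegree ≤ D''.modularDegree) →
    Nat.card (W.toAffine.Point[(2 : ℤ)]) = 1 →
    Nat.card (W.selmerGroup 2) * 2 ^ (oddPrimeCount (W.conductorNorm ℤ) + twoAdicFloorAtTwo (padicValNat 2 (W.conductorNorm ℤ))) ≤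
      2 * 2 ^ (padicValNat 2 D.modularDegree)

/-- **ES-32B on the slice, in the form the route consumes: `ALMinimalDegreeSelmerTrivialOnSlice`.**  For the crux's `W` (non-CM, surjective
`2`-adic image, odd torsion, odd Tamagawa product, analytic rank `1`): if the optimal modular degree sits ON the Atkin–Lehner floor,
`v₂(deg) = ω_odd(N) + c(v₂ N)` («AL-minimal degree»; `1 435` of the `3 770` slice curves with `N ≤ 10⁴`, `9 613` of `32 637` with `N ≤ 10⁵`), then `Sel₂(W) ≅ ℤ/2`, hence
`Ш(W)[2] = 0` and `Ш(W)[2^∞] = 0`: the ALGEBRAIC half of `BSD₂(W)` on that sub-slice, leaving `v₂(L'(W,1)/Ω_W R_W) = 0` (the one-door /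
Zhang-at-2 analytic statement).  Census: `1 435 / 1 435` (slice, `N ≤ 10⁴`) and `9 613 / 9 613` (slice, `N ≤ 10⁵`, kit j334983 — while `60` slice curves off the floor have `Ш[2] ≅ (ℤ/2)²`), `2 160 / 2 160` resp. `13 064 / 13 064` (all rank-1 `W[2]`-surjective), `842 / 842` resp. `4 677 / 4 677` rank-0 analogues (`v₂(deg) = ω_odd + c − 1 ⟹ Sel₂ = 0`), ENGINE 32S j334662 / j334983.  A consequence of `SelmerAtkinLehnerFloorAtTwo`. -/
@[conjecture] def ALMinimalDegreeSelmerTrivialOnSlice : Prop :=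
  ∀ (W : WeierstrassCurve ℚ) [W.IsElliptic] [W.IsGloballyMinimal] [NeZero (W.conductorNorm ℤ)],
    ¬ W.HasCM → (∀ n : ℕ, W.HasSurjectiveModNGaloisRep ((2 ^ n : ℕ) : ℤ)) → Odd W.torsionOrder → Odd W.tamagawaProduct →
    W.analyticRank = 1 →
    ∀ (D : ModularParametrizationData W (W.conductorNorm ℤ)),
    (∀ (W'' : WeierstrassCurve ℚ) [W''.IsElliptic] (D'' : ModularParametrizationData W'' (W.conductorNorm ℤ)),
        D''.f = D.f → D.modularDegree ≤ D''.modularDegree) →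
    padicValNat 2 D.modularDegree = oddPrimeCount (W.conductorNorm ℤ) + twoAdicFloorAtTwo (padicValNat 2 (W.conductorNorm ℤ)) →
    Nat.card (W.selmerGroup 2) ≤ 2

/-- Elementary glue: the sharp floor implies the slice statement (pure arithmetic on the exponents: `#Sel₂ · 2^{k} ≤ 2 · 2^{k}`). -/
theorem alMinimal_of_floor (h : SelmerAtkinLehnerFloorAtTwo)
    (W : WeierstrassCurve ℚ) [W.IsElliptic] [W.IsGloballyMinimal] [NeZero (W.conductorNorm ℤ)]
    (h2 : Nat.card (W.toAffine.Point[(2 : ℤ)]) = 1)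
    (D : ModularParametrizationData W (W.conductorNorm ℤ))
    (hopt : ∀ (W'' : WeierstrassCurve ℚ) [W''.IsElliptic] (D'' : ModularParametrizationData W'' (W.conductorNorm ℤ)),
        D''.f = D.f → D.modularDegree ≤ D''.modularDegree)
    (hmin : padicValNat 2 D.modularDegree = oddPrimeCount (W.conductorNorm ℤ) + twoAdicFloorAtTwo (padicValNat 2 (W.conductorNorm ℤ))) :
    Nat.card (W.selmerGroup 2) ≤ 2 := by
  have := h W D hopt h2
  rw [hmin] at this
  have hp : 0 < 2 ^ (oddPrimeCount (W.conductorNorm ℤ) + twoAdicFloorAtTwo (padicValNat 2 (W.conductorNorm ℤ))) := by positivity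
  nlinarith

end Summit.BirchSwinnertonDyer.BirchSwinnertonDyer.Theorems.RankOneAtTwoTamagawaExponent

end
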